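import Summits.ResolutionOfSingularities.ResolutionOfSingularities.Theorems.EquisingularLiftEquisingularLiftNatPlaneChartLocalization
import Summits.ResolutionOfSingularities.ResolutionOfSingularities.Theorems.EquisingularLiftEquisingularLiftNatConeDeltaRegularCarrier
import HarnessLib

/-!
# [OURS · L1 W4.5(b) · EL♮(3)] B7★ CONE-DELTA TRANSPORT, carrier side (2/2): the (H-model) hypothesis of K8 (γ) and
# `TCPlus.ConeDeltaRegular c Φ′` from the two plane chart clauses of T-ΔLIFT-CENTRED
# (crux `EquisingularLiftNatThree` stmt-ResolutionOfSingularities-20148 / parent 20038; rung v7 TC⁺, brick `inv_base`)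

NOT a statement of any manuscript. Helper file of the chain res-L1-w45b (cell `res-hironaka`, LADDER-RESOLUTION rung L, slot W4.5(b));
OURS; AI-written, weaker than expert review; `--supports stmt-ResolutionOfSingularities-20148 --as helper` by res-L1-w45b-stub-3 (object
B7★ of the K8/INV board, res-L1-w45b-stub-1 RULING 2026-08-27T13:44:20Z / res-L1-w45b-plan-1 ACK 13:46:12Z, consuming res-L1-w45b-stub-2's
K8 (γ) `coneDeltaRegular_of_carrier_of_rsop`, p535712). No `sorry`; standard axioms. It closes nothing by itself.

WHAT. Part 1 (…NatPlaneChartLocalization, `isRegularLocalRing_quot_of_planeChart`) is the one-chart core for an abstract localised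
polynomial carrier `A₀ = Λ[U₁,U₂]_𝔫`. Here `A₀ = A/(c₀)` for a local ring `A` with frame `c = (c₀, c₁, c₂)` and cone form
`Φ′ ∈ A[Z₁,Z₂]_m` — the data of res-L1-w45b-stub-1's `TCPlus.ConeDeltaRegular c Φ′` (p532383) at the cone point of a
`CentredPackage` — and the two charts `j = 0, 1` are fed by res-L1-w45b-stub-1's T-ΔLIFT-CENTRED (p523916) in its own binders:
`Φ ∈ Λ[T₀,T₁,T₂]`, `Φ(1, X, XY) = Xᵐ·Φu`, `Φ(1, XY, Y) = Yᵐ·Φv`, and the local rings of `Λ[X,Y]/(Φu)`, `Λ[X,Y]/(Φv)` at primes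
containing `C ϖ` are regular.

* `eval_map_mk_tail`, `aeval_subst_zero_aeval_dehom`, `aeval_subst_one_aeval_dehom` — bookkeeping: reduction mod `c₀` of `Φ′(c₁,c₂)`;
  the chart substitutions `κ₀ : (U₁,U₂) ↦ (X₀, X₀X₁)`, `κ₁ : (U₁,U₂) ↦ (X₁X₀, X₁)` after `T ↦ (1,U₁,U₂)` are p523916's charts `u`, `v`;
* **`coneDeltaRegular_hcar_of_planeCharts`** — the (H-model) hypothesis `hcar` of (γ) `coneDeltaRegular_of_carrier(_of_rsop)`
  VERBATIM (`r = 2`), from: a presentation `ψ : Λ[U₁,U₂] → A/(c₀)` of the carrier as the localisation at a prime `𝔫 ∋ C ϖ` with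
  `ψ(U_l) = c̄_{l+1}`, `Φ′(c₁,c₂) ≡ ψ(Φ(1,U₁,U₂)) (mod c₀)`, and the two chart clauses (same `m`);
* **`coneDeltaRegular_of_planeCharts`** — `TCPlus.ConeDeltaRegular c Φ′` itself, composing with (γ) `coneDeltaRegular_of_carrier_of_rsop`
  (side conditions `(c) + (ϖ_A) = 𝔪_A`, `dim A = 4`, `Φ′ mod 𝔪_A ≠ 0` — res-L1-w45b-stub-2 …NatInCarrierStepFlatRing).

The presentation `ψ` of the carrier stalk from a blow-up chart presentation of `A` itself (res-type-100 / res-D-pv-029 B1★ currency: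
`A ≅ (R[c/c₀])_𝔔₀` along `χ`, `R/(c) ≅ Λ`) is part 3 (…NatConeDeltaPlaneChartsPresentation). (Part 1's header refers to this file as «…NatConeDeltaTransport»; it was filed as
…NatConeDeltaPlaneCharts to keep clear of res-L1-w45b-stub-2's …NatConeDeltaRegularTransport.)

References: U. Görtz, T. Wedhorn, *Algebraic Geometry I* (2020), Prop. 13.96 (2) p. 416 [cite: GortzWedhorn2020]; H. Matsumura,
*Commutative Ring Theory* (1986), Thm. 14.2 [cite: Matsumura1987]. Tree inputs: part 1, p535712 (γ), p523916 (chart clause shape).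
-/

set_option linter.dupNamespace false -- mandated namespace `Summit.<Summit>.<Problem>` of this single-conjunct summit

noncomputable section

namespace Summit.ResolutionOfSingularities.ResolutionOfSingularities.Cruxes.EquisingularLiftNat.Sections.TCPlus

open MvPolynomial IsLocalRing Literature.AlgebraicGeometry.Resolution
open Summit.ResolutionOfSingularities.ResolutionOfSingularities.Cruxes.EquisingularLiftNat.Sections

universe u

/-! ## The (H-model) hypothesis of K8 (γ) and `ConeDeltaRegular` -/

section Package

/-- Reduction mod `c₀` commutes with evaluation of the cone form at the tail. [folklore] -/
theorem eval_map_mk_tail {A : Type u} [CommRing A] (c : Fin 3 → A) (Φ' : MvPolynomial (Fin 2) A) :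
    MvPolynomial.eval (fun l : Fin 2 => Ideal.Quotient.mk (Ideal.span ({c 0} : Set A)) (c l.succ))
        (MvPolynomial.map (Ideal.Quotient.mk (Ideal.span ({c 0} : Set A))) Φ') =
      Ideal.Quotient.mk (Ideal.span ({c 0} : Set A)) (MvPolynomial.eval (fun l : Fin 2 => c l.succ) Φ') := by
  rw [MvPolynomial.eval_map, show MvPolynomial.eval (fun l : Fin 2 => c l.succ) Φ' =
    MvPolynomial.eval₂ (RingHom.id _) (fun l : Fin 2 => c l.succ) Φ' from rfl, MvPolynomial.eval₂_comp_left, RingHom.comp_id]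
  rfl

/-- The chart substitution `κ₀` after `T ↦ (1, U₁, U₂)` is p523916's chart `u`: `T ↦ (1, X, XY)`. [folklore] -/
theorem aeval_subst_zero_aeval_dehom {Λ : Type u} [CommRing Λ] (Φ : MvPolynomial (Fin 3) Λ) :
    MvPolynomial.aeval (R := Λ) (fun l : Fin 2 => if l = (0 : Fin 2) then (X 0 : MvPolynomial (Fin 2) Λ) else X 0 * X l)
        (MvPolynomial.aeval (![1, X 0, X 1] : Fin 3 → MvPolynomial (Fin 2) Λ) Φ) =
      MvPolynomial.aeval (![1, X 0, X 0 * X 1] : Fin 3 → MvPolynomial (Fin 2) Λ) Φ := by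
  rw [MvPolynomial.comp_aeval_apply]
  have hfun : (fun i : Fin 3 => MvPolynomial.aeval (R := Λ)
      (fun l : Fin 2 => if l = (0 : Fin 2) then (X 0 : MvPolynomial (Fin 2) Λ) else X 0 * X l)
      ((![1, X 0, X 1] : Fin 3 → MvPolynomial (Fin 2) Λ) i)) = (![1, X 0, X 0 * X 1] : Fin 3 → MvPolynomial (Fin 2) Λ) := by
    funext i
    fin_cases i <;> simp
  rw [hfun]

/-- The chart substitution `κ₁` after `T ↦ (1, U₁, U₂)` is p523916's chart `v`: `T ↦ (1, XY, Y)`. [folklore] -/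
theorem aeval_subst_one_aeval_dehom {Λ : Type u} [CommRing Λ] (Φ : MvPolynomial (Fin 3) Λ) :
    MvPolynomial.aeval (R := Λ) (fun l : Fin 2 => if l = (1 : Fin 2) then (X 1 : MvPolynomial (Fin 2) Λ) else X 1 * X l)
        (MvPolynomial.aeval (![1, X 0, X 1] : Fin 3 → MvPolynomial (Fin 2) Λ) Φ) =
      MvPolynomial.aeval (![1, X 0 * X 1, X 1] : Fin 3 → MvPolynomial (Fin 2) Λ) Φ := by
  rw [MvPolynomial.comp_aeval_apply]
  have hfun : (fun i : Fin 3 => MvPolynomial.aeval (R := Λ)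
      (fun l : Fin 2 => if l = (1 : Fin 2) then (X 1 : MvPolynomial (Fin 2) Λ) else X 1 * X l)
      ((![1, X 0, X 1] : Fin 3 → MvPolynomial (Fin 2) Λ) i)) = (![1, X 0 * X 1, X 1] : Fin 3 → MvPolynomial (Fin 2) Λ) := by
    funext i
    fin_cases i <;> simp [mul_comm]
  rw [hfun]

variable {A : Type u} [CommRing A] [IsLocalRing A] (c : Fin 3 → A) (Φ' : MvPolynomial (Fin 2) A)
  {Λ : Type u} [CommRing Λ] [IsDomain Λ] (ϖ : Λ)
  (ψ : MvPolynomial (Fin 2) Λ →+* A ⧸ Ideal.span ({c 0} : Set A)) (𝔫 : Ideal (MvPolynomial (Fin 2) Λ)) [𝔫.IsPrime]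

/-- **B7★ — the (H-model) hypothesis `hcar` of K8 (γ) (`coneDeltaRegular_of_carrier`, `r = 2`) from the plane chart clauses.**
`A` local with frame `c = (c₀, c₁, c₂)` and cone form `Φ′ ∈ A[Z₁,Z₂]_m`; `Λ` a domain (`Λ = O`), `ψ : Λ[U₁,U₂] → A/(c₀)`
presenting the carrier as the localisation at a prime `𝔫 ∋ C ϖ` with `ψ(U_l) = c̄_{l+1}`; `Φ ∈ Λ[T₀,T₁,T₂]` with
`Φ′(c₁,c₂) ≡ ψ(Φ(1,U₁,U₂)) (mod c₀)`; p523916's chart clauses: `Φ(1,X,XY) = Xᵐ·Φu`, `Φ(1,XY,Y) = Yᵐ·Φv` and the local rings of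
`Λ[X,Y]/(Φu)`, `Λ[X,Y]/(Φv)` at primes containing `ϖ` are regular. THEN (H-model): for each chart `j`, every prime `𝔮` of the
carrier's blow-up chart `(A/c₀)[c̄′/c̄_j]` over `𝔪_A` containing `Φ̄′(ē′)`, and every model `T` of its local ring, `T ⧸ (Φ̄′(ē′))` is a
regular local ring. [cite: GortzWedhorn2020, Prop. 13.96 (2) p. 416] [OURS · L1 W4.5b] B7★ for res-type-100's `inv_base`
(CentredPackage at the cone point); NOT a statement of the manuscript. -/
theorem coneDeltaRegular_hcar_of_planeCharts (hloc : @IsLocalization.AtPrime _ _ (A ⧸ Ideal.span ({c 0} : Set A)) _ ψ.toAlgebra 𝔫 _)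
    (hϖ : MvPolynomial.C ϖ ∈ 𝔫) (hψ : ∀ l : Fin 2, ψ (X l) = Ideal.Quotient.mk (Ideal.span ({c 0} : Set A)) (c l.succ))
    {m : ℕ} (hΦ'd : Φ'.IsHomogeneous m) (Φ : MvPolynomial (Fin 3) Λ) (Φu Φv : MvPolynomial (Fin 2) Λ)
    (hΦu : MvPolynomial.aeval (![1, X 0, X 0 * X 1] : Fin 3 → MvPolynomial (Fin 2) Λ) Φ = X 0 ^ m * Φu)
    (hΦv : MvPolynomial.aeval (![1, X 0 * X 1, X 1] : Fin 3 → MvPolynomial (Fin 2) Λ) Φ = X 1 ^ m * Φv)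
    (hΦ' : Ideal.Quotient.mk (Ideal.span ({c 0} : Set A)) (MvPolynomial.eval (fun l : Fin 2 => c l.succ) Φ') =
      ψ (MvPolynomial.aeval (![1, X 0, X 1] : Fin 3 → MvPolynomial (Fin 2) Λ) Φ))
    (hregu : ∀ (Q : Ideal (MvPolynomial (Fin 2) Λ ⧸ Ideal.span {Φu})) [Q.IsPrime],
      Ideal.Quotient.mk (Ideal.span {Φu}) (MvPolynomial.C ϖ) ∈ Q → IsRegularLocalRing (Localization.AtPrime Q))
    (hregv : ∀ (Q : Ideal (MvPolynomial (Fin 2) Λ ⧸ Ideal.span {Φv})) [Q.IsPrime],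
      Ideal.Quotient.mk (Ideal.span {Φv}) (MvPolynomial.C ϖ) ∈ Q → IsRegularLocalRing (Localization.AtPrime Q)) :
    ∀ (j' : Fin 2)
      (𝔮 : Ideal (blowupAlgebra (Ideal.span (Set.range fun l : Fin 2 => Ideal.Quotient.mk (Ideal.span {c 0}) (c l.succ)))
        ((fun l : Fin 2 => Ideal.Quotient.mk (Ideal.span {c 0}) (c l.succ)) j'))) [𝔮.IsPrime],
      𝔮.comap ((algebraMap (A ⧸ Ideal.span {c 0}) _).comp (Ideal.Quotient.mk (Ideal.span {c 0}))) = maximalIdeal A →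
      MvPolynomial.aeval (blowupAlgebra.frac (fun l : Fin 2 => Ideal.Quotient.mk (Ideal.span {c 0}) (c l.succ)) j')
          (MvPolynomial.map (Ideal.Quotient.mk (Ideal.span {c 0})) Φ') ∈ 𝔮 →
      ∀ (T : Type u) [CommRing T]
        [Algebra (blowupAlgebra (Ideal.span (Set.range fun l : Fin 2 => Ideal.Quotient.mk (Ideal.span {c 0}) (c l.succ)))
          ((fun l : Fin 2 => Ideal.Quotient.mk (Ideal.span {c 0}) (c l.succ)) j')) T] [IsLocalization.AtPrime T 𝔮],
        IsRegularLocalRing (T ⧸ Ideal.span {algebraMap _ T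
          (MvPolynomial.aeval (blowupAlgebra.frac (fun l : Fin 2 => Ideal.Quotient.mk (Ideal.span {c 0}) (c l.succ)) j')
            (MvPolynomial.map (Ideal.Quotient.mk (Ideal.span {c 0})) Φ'))}) := by
  classical
  haveI : IsLocalRing (A ⧸ Ideal.span ({c 0} : Set A)) := planeChart_loc_isLocalRing ψ 𝔫 hloc
  intro j' 𝔮 _ h𝔮 hmem T _ _ _
  -- `𝔮` lies over the maximal ideal of the carrier
  have h𝔮' : 𝔮.comap (algebraMap (A ⧸ Ideal.span ({c 0} : Set A)) _) = maximalIdeal (A ⧸ Ideal.span ({c 0} : Set A)) := by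
    have h1 : 𝔮.comap (algebraMap (A ⧸ Ideal.span ({c 0} : Set A)) _) =
        (maximalIdeal A).map (Ideal.Quotient.mk (Ideal.span ({c 0} : Set A))) := by
      rw [← h𝔮, ← Ideal.comap_comap, Ideal.map_comap_of_surjective _ Ideal.Quotient.mk_surjective]
    rcases Ideal.map_eq_top_or_isMaximal_of_surjective (Ideal.Quotient.mk (Ideal.span ({c 0} : Set A)))
      Ideal.Quotient.mk_surjective (IsLocalRing.maximalIdeal.isMaximal A) with htop | hmax
    · exact absurd (h1.trans htop) (Ideal.IsPrime.ne_top inferInstance)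
    · rw [h1]
      exact IsLocalRing.eq_maximalIdeal hmax
  have hF : MvPolynomial.eval (fun l : Fin 2 => Ideal.Quotient.mk (Ideal.span ({c 0} : Set A)) (c l.succ))
      (MvPolynomial.map (Ideal.Quotient.mk (Ideal.span ({c 0} : Set A))) Φ') =
      ψ (MvPolynomial.aeval (![1, X 0, X 1] : Fin 3 → MvPolynomial (Fin 2) Λ) Φ) := by
    rw [eval_map_mk_tail, hΦ']
  have hj' : j' = 0 ∨ j' = 1 := by fin_cases j' <;> simp
  rcases hj' with rfl | rfl
  · refine isRegularLocalRing_quot_of_planeChart ψ 𝔫 _ 0 hloc hϖ hψ _ (hΦ'd.map _) _ Φu hF ?_ hregu 𝔮 h𝔮' hmem T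
    rw [aeval_subst_zero_aeval_dehom, hΦu]
  · refine isRegularLocalRing_quot_of_planeChart ψ 𝔫 _ 1 hloc hϖ hψ _ (hΦ'd.map _) _ Φv hF ?_ hregv 𝔮 h𝔮' hmem T
    rw [aeval_subst_one_aeval_dehom, hΦv]

/-- **B7★ CONE-DELTA TRANSPORT — `TCPlus.ConeDeltaRegular c Φ′` from the plane chart clauses of T-ΔLIFT-CENTRED**, composing
`coneDeltaRegular_hcar_of_planeCharts` with res-L1-w45b-stub-2's K8 (γ) `coneDeltaRegular_of_carrier_of_rsop` (p535712): `A`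
Noetherian local with `(c) + (ϖ_A) = 𝔪_A`, `dim A = 4`, `Φ′` a form of degree `m` with `Φ′ mod 𝔪_A ≠ 0`, and the carrier /
plane-chart data of `coneDeltaRegular_hcar_of_planeCharts`. [cite: Matsumura1987, Thm. 14.2] [OURS · L1 W4.5b] B7★ for
res-type-100's `inv_base` (CentredPackage at the cone point `p_c`); NOT a statement of the manuscript. -/
theorem coneDeltaRegular_of_planeCharts [IsNoetherianRing A] (ϖA : A)
    (h𝔪 : Ideal.span (Set.range c) ⊔ Ideal.span {ϖA} = maximalIdeal A) (hdim : ringKrullDim A = (2 + 2 : ℕ))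
    {m : ℕ} (hΦ'd : Φ'.IsHomogeneous m) (hΦ'𝔪 : MvPolynomial.map (IsLocalRing.residue A) Φ' ≠ 0)
    (hloc : @IsLocalization.AtPrime _ _ (A ⧸ Ideal.span ({c 0} : Set A)) _ ψ.toAlgebra 𝔫 _)
    (hϖ : MvPolynomial.C ϖ ∈ 𝔫) (hψ : ∀ l : Fin 2, ψ (X l) = Ideal.Quotient.mk (Ideal.span ({c 0} : Set A)) (c l.succ))
    (Φ : MvPolynomial (Fin 3) Λ) (Φu Φv : MvPolynomial (Fin 2) Λ)
    (hΦu : MvPolynomial.aeval (![1, X 0, X 0 * X 1] : Fin 3 → MvPolynomial (Fin 2) Λ) Φ = X 0 ^ m * Φu)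
    (hΦv : MvPolynomial.aeval (![1, X 0 * X 1, X 1] : Fin 3 → MvPolynomial (Fin 2) Λ) Φ = X 1 ^ m * Φv)
    (hΦ' : Ideal.Quotient.mk (Ideal.span ({c 0} : Set A)) (MvPolynomial.eval (fun l : Fin 2 => c l.succ) Φ') =
      ψ (MvPolynomial.aeval (![1, X 0, X 1] : Fin 3 → MvPolynomial (Fin 2) Λ) Φ))
    (hregu : ∀ (Q : Ideal (MvPolynomial (Fin 2) Λ ⧸ Ideal.span {Φu})) [Q.IsPrime],
      Ideal.Quotient.mk (Ideal.span {Φu}) (MvPolynomial.C ϖ) ∈ Q → IsRegularLocalRing (Localization.AtPrime Q))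
    (hregv : ∀ (Q : Ideal (MvPolynomial (Fin 2) Λ ⧸ Ideal.span {Φv})) [Q.IsPrime],
      Ideal.Quotient.mk (Ideal.span {Φv}) (MvPolynomial.C ϖ) ∈ Q → IsRegularLocalRing (Localization.AtPrime Q)) :
    ConeDeltaRegular c Φ' :=
  coneDeltaRegular_of_carrier_of_rsop c Φ' ϖA h𝔪 hdim hΦ'd hΦ'𝔪
    (coneDeltaRegular_hcar_of_planeCharts c Φ' ϖ ψ 𝔫 hloc hϖ hψ hΦ'd Φ Φu Φv hΦu hΦv hΦ' hregu hregv)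

end Package

end Summit.ResolutionOfSingularities.ResolutionOfSingularities.Cruxes.EquisingularLiftNat.Sections.TCPlus

end
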